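import Summits.BirchSwinnertonDyer.BirchSwinnertonDyer.Theorems.PrintCf2SplitBadTwoCMLocalEndomorphism
import Summits.BirchSwinnertonDyer.BirchSwinnertonDyer.Theorems.PrintCf2SplitBadTwoCMTwoTorsionField
import Literature.NumberTheory.EllipticCurves.ShaRestrictionJZeroLocalDescent
import HarnessLib

/-!
# Crux `PrintCf2.SplitBadTwoRankOneOfFacts` (item stmt-BirchSwinnertonDyer-20368), road α over the CM field:
# EXACT LOCAL DESCENT of `H¹(·, E)` along a tower `ℚ → E → E' = E + E·√−7` for `j(E) = −3375`

Cell `bsd-print-cf2`, width seat `bsd-line-cf2-p1-w8` g2 (brick **B6e-i**, part 2: the local statement of the Ш local descent of memo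
`Cruxes/SplitBadTwoRankOneOfFacts/SHA-CM-DESCENT-w8g0.md` §«What is missing»); `--supports stmt-BirchSwinnertonDyer-20368` (helper).
HONEST FRAMING: nothing here closes a crux or a stub; BSD is not proved by any of this; no summit statement is proved by this seat.
No definition is introduced. beyond-print theorem: no.

**`mem_localRestrictionKer_of_tower_cm7`** — the twin, for the complex multiplication `π = [(1+√−7)/2]` of a `j = −3375` curve
`W/ℚ`, of the tree's `JZero.mem_localRestrictionKer_of_tower` (`ShaRestrictionJZeroLocalDescent`, `j = 0`, `[ω]`): for a tower of
fields `ℚ → E → E'` with `E' = E + E·θ₁`, `θ₁² = −7` (`E'/E` finite; `E'` also an algebra over a number field `L ∋ θ` with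
`θ ↦ θ₁` — e.g. `ℚ_v → L_w` for `L = ℚ(√−7)`), a class of `H¹(ℚ, E)` that dies in `H¹(E', E)` already dies in `H¹(E, E)`:
`localRestrictionKer W E' ≤ localRestrictionKer W E` (the converse of the tree's `localRestrictionKer_le_of_tower`, WITHOUT the
factor `2` of `index_nsmul_mem_localRestrictionKer_of_tower`). In words: `H¹(Gal(E'/E), E(E')) = 0` because `E(Ē)` is a
`ℤ[π]`-module on which an element `g₀` moving `√−7` acts `π`-SEMILINEARLY (`g₀ π g₀⁻¹ = π̄ = 1 − π`) and `π` has TRACE ONE: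
for an inflated crossed homomorphism `f` the value `P = f g₀` is `N`-fixed and `g₀ P = −P`, and `Q := −πP` satisfies
`g₀ Q − Q = P − πP + πP = P`.

Steps 1–3 are the JZero template verbatim (restriction through the middle field `resGalOfEmb_comp_tower`; the middle kernel is
inflated from the open subgroup `N = galRange E'` = the stabiliser of the embedded `θ' = j θ₁`, `resKer_le_range_inflClass`;
every element of `Γ_E` sends `θ'` to `±θ'`, so `N` is normal with `Γ_E = N ∪ N g₀`). Step 4 uses THIS SEAT's `π` on `E(Ē)`
(`exists_local_cmEndo_two`, file `…CMLocalEndomorphism`: `π ∈ End_{Ē}(E_E)`, `π² = π − 2`, `#ker π = #ker π̄ = 2`, commuting with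
`N`) and -w8 g0's `smul_cmEndo_eq_of_coset_of_not_isSquare` (file `…CMTwoTorsionField`: over `E ∌ √−7` the coset `N g₀`
anti-commutes) — `√−7 ∉ E` BECAUSE `g₀ θ' = −θ' ≠ θ'`. If no `g₀` exists, `N = Γ_E` and `f = 0`.

References: J.-P. Serre, *Galois Cohomology* (1997), I.§2.4 (Prop. 9 and Cor.), I.§5.8, II.§1.1 [SerreGaloisCohomology1997];
[SilvermanAEC2009] III.§4, X.4; [SilvermanATAEC1994] II §2 Thm. 2.2(b); B. H. Gross, LMS LNS 153 (1991) §5 (5.1) (the analogous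
`Gal(K/ℚ)`-descent for Heegner points). [GrossLMS1991]
-/

noncomputable section

open scoped Classical

set_option linter.dupNamespace false
set_option autoImplicit false

namespace Summit.BirchSwinnertonDyer.BirchSwinnertonDyer.Theorems.PrintCf2.CMPrimes

open WeierstrassCurve Literature.NumberTheory.EllipticCurves Literature.NumberTheory.GaloisRepresentations Field IntermediateField

/-! ## §1 The embedded copy of `E'` in `Ē` and `galRange E'` (the two private lemmas of `ShaRestrictionJZeroLocalDescent`, re-proved) -/

section EmbeddedCopy

variable {E : Type} [Field E] (E' : Type) [Field E'] [Algebra E E'] [Algebra.IsAlgebraic E E']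

/-- Elements of `galRange E' = res(Γ_{E'}) ≤ Γ_E` fix the copy `j(E')` of `E'` inside `Ē` (`j = e⁻¹ ∘ (E' → Ē')`, `e : Ē ≃ Ē'`
the isomorphism of the chosen embedding). Serre, *Galois Cohomology*, II.§1.1; the tree's private
`ShaRestrictionJZeroLocalDescent.apply_eq_of_mem_galRange`. [folklore] -/
theorem apply_eq_of_mem_galRange' (j : E' →ₐ[E] AlgebraicClosure E)
    (hj : ∀ x, algEquivOfEmb E' (closureEmb (K := E) E') (j x) = algebraMap E' (AlgebraicClosure E') x)
    {g : absoluteGaloisGroup E} (hg : g ∈ galRange (K := E) E') (x : E') :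
    (show AlgebraicClosure E ≃ₐ[E] AlgebraicClosure E from g) (j x) = j x := by
  obtain ⟨σ, rfl⟩ := hg
  apply (algEquivOfEmb E' (closureEmb (K := E) E')).injective
  change algEquivOfEmb E' (closureEmb (K := E) E')
      ((show AlgebraicClosure E ≃ₐ[E] AlgebraicClosure E from resGal (K := E) E' σ) _) = _
  rw [algEquivOfEmb_resGal_apply, hj, AlgEquiv.commutes]

/-- Conversely, an element of `Γ_E` fixing `j(E')` pointwise lies in `galRange E'` (it extends through `e` to an `E'`-automorphism
of `Ē'`). Serre, *Galois Cohomology*, II.§1.1; the tree's private `ShaRestrictionJZeroLocalDescent.mem_galRange_of_forall_apply_eq`.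
[folklore] -/
theorem mem_galRange_of_forall_apply_eq' (j : E' →ₐ[E] AlgebraicClosure E)
    (hj : ∀ x, algEquivOfEmb E' (closureEmb (K := E) E') (j x) = algebraMap E' (AlgebraicClosure E') x)
    {g : absoluteGaloisGroup E} (hg : ∀ x : E', (show AlgebraicClosure E ≃ₐ[E] AlgebraicClosure E from g) (j x) = j x) :
    g ∈ galRange (K := E) E' := by
  let ι : AlgebraicClosure E →ₐ[E] AlgebraicClosure E' := closureEmb (K := E) E'
  let e : AlgebraicClosure E ≃ₐ[E] AlgebraicClosure E' := algEquivOfEmb E' ι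
  let g' : AlgebraicClosure E ≃ₐ[E] AlgebraicClosure E := g
  let r : AlgebraicClosure E' ≃+* AlgebraicClosure E' := (e.symm.toRingEquiv.trans g'.toRingEquiv).trans e.toRingEquiv
  have hr : ∀ z, r z = e (g' (e.symm z)) := fun z ↦ rfl
  have hrL : ∀ x : E', r (algebraMap E' (AlgebraicClosure E') x) = algebraMap E' (AlgebraicClosure E') x := by
    intro x
    rw [hr]
    have h1 : e.symm (algebraMap E' (AlgebraicClosure E') x) = j x := by
      apply e.injective
      rw [AlgEquiv.apply_symm_apply]
      exact (hj x).symm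
    rw [h1]
    change e ((show AlgebraicClosure E ≃ₐ[E] AlgebraicClosure E from g) (j x)) = _
    rw [hg x]
    exact hj x
  let σ : AlgebraicClosure E' ≃ₐ[E'] AlgebraicClosure E' := AlgEquiv.ofRingEquiv (f := r) hrL
  refine ⟨σ, ?_⟩
  apply AlgEquiv.ext
  intro z
  apply ι.injective
  change ι ((show AlgebraicClosure E ≃ₐ[E] AlgebraicClosure E from resGalAuxOfEmb ι σ) z) = ι (g' z)
  rw [apply_resGalAuxOfEmb_apply]
  change r (ι z) = ι (g' z)
  rw [hr]
  have h2 : e.symm (ι z) = z := by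
    rw [← algEquivOfEmb_apply E' ι z]
    exact e.symm_apply_apply z
  rw [h2]
  rfl

end EmbeddedCopy

/-! ## §2 Exact local descent along `E' = E + E·θ₁ ⊇ E` from a TRACE-ONE semilinear endomorphism of `E(Ē)` (generic base) -/

section Generic

variable {K : Type} [Field K] (W : WeierstrassCurve K)
variable {E : Type} [Field E] [Algebra K E] [CharZero E]
variable {E' : Type} [Field E'] [Algebra K E'] [Algebra E E'] [IsScalarTower K E E'] [FiniteDimensional E E']

/-- **Exact local descent from a trace-one witness map (generic base field).** `W/K`, `K → E → E'` a tower of fields with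
`E'/E` finite and `E' = E + E·θ₁` where `θ₁² = a ∈ E`, `a ≠ 0` (`char E = 0`). Suppose that whenever `θ₁ ∉ E` and `g₀ ∈ Γ_E`
represents the non-trivial coset of `N = galRange E'` (`Γ_E = N ∪ N g₀`) there is an additive `π : E(Ē) → E(Ē)` commuting with
`N` and with `g₀ π g₀⁻¹ = 1 − π` (`g₀ • π R = g₀ • R − π (g₀ • R)`). Then a class of `H¹(K, E)` dying in `H¹(E', E)` dies in
`H¹(E, E)`. Steps 1–3 are the tree's `JZero.mem_localRestrictionKer_of_tower` verbatim (restriction through the middle field,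
`resGalOfEmb_comp_tower`; the middle kernel is inflated from the open `N = galRange E'`, `resKer_le_range_inflClass`, which is the
stabiliser of the embedded `θ' = j θ₁`; every element of `Γ_E` sends `θ'` to `±θ'`, so `N` is normal of index `≤ 2`); Step 4: for
an inflated crossed homomorphism `f`, `P = f g₀` is `N`-fixed with `g₀ P = −P`, and `Q := −πP` has `g₀Q − Q = P − πP + πP = P`
(`inflClass_eq_zero_of_index_two_of_witness`); if `θ'` is `Γ_E`-fixed, `N = Γ_E` and `f = 0`. Serre, *Galois Cohomology*, I.§2.4,
I.§5.8, II.§1.1. [cite: SerreGaloisCohomology1997, I.§2.4 (Prop. 9 and Cor.) and I.§5.8] -/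
theorem mem_localRestrictionKer_of_tower_of_traceOne {a : E} (ha : a ≠ 0) {θ₁ : E'} (hθ₁ : θ₁ ^ 2 = algebraMap E E' a)
    (hE' : ∀ x : E', ∃ b c : E, x = algebraMap E E' b + algebraMap E E' c * θ₁)
    (hπ : θ₁ ∉ Set.range (algebraMap E E') → ∀ g₀ : absoluteGaloisGroup E,
      (∀ g : absoluteGaloisGroup E, g ∈ galRange (K := E) E' ∨ g * g₀⁻¹ ∈ galRange (K := E) E') →
      ∃ π : localPoints W E →+ localPoints W E,
        (∀ n ∈ galRange (K := E) E', ∀ R : localPoints W E, π (n • R) = n • π R) ∧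
        ∀ R : localPoints W E, g₀ • π R = g₀ • R - π (g₀ • R))
    {c : W.galH1} (hc : c ∈ W.localRestrictionKer E') : c ∈ W.localRestrictionKer E := by
  haveI : Algebra.IsAlgebraic E E' := Algebra.IsAlgebraic.of_finite E E'
  haveI : CharZero E' := charZero_of_injective_algebraMap (algebraMap E E').injective
  haveI : CharZero (AlgebraicClosure E) :=
    charZero_of_injective_algebraMap (algebraMap E (AlgebraicClosure E)).injective
  let ι₁ : AlgebraicClosure K →ₐ[K] AlgebraicClosure E := closureEmb (K := K) E
  let ι₂ : AlgebraicClosure E →ₐ[E] AlgebraicClosure E' := closureEmb (K := E) E'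
  -- Step 1: `hc` as membership of `res_E c` in the kernel of the middle restriction
  rw [← WeierstrassCurve.localRestrictionKerOfEmb_eq_holds W E' ((ι₂.restrictScalars K).comp ι₁)] at hc
  change c ∈ resKer (resGalOfEmb ((ι₂.restrictScalars K).comp ι₁))
    (pointsMapOfEmb W ((ι₂.restrictScalars K).comp ι₁)) (pointsMapOfEmb_smul W _) at hc
  rw [resKer_eq_ker, AddMonoidHom.mem_ker,
    resH1Hom_congr (resGalOfEmb_comp_tower ι₁ ι₂) (pointsMapOfEmb_comp_tower W ι₁ ι₂) _
      (fun x m ↦ by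
        simp only [ContinuousMonoidHom.comp_toFun, AddMonoidHom.coe_comp, Function.comp_apply,
          pointsMapOfEmb_smul, pointsMapTower_smul]),
    ← resH1Hom_comp (resGalOfEmb ι₁) (pointsMapOfEmb W ι₁) (pointsMapOfEmb_smul W ι₁)
      (resGalOfEmb (K := E) ι₂) _ (pointsMapTower_smul W ι₂), AddMonoidHom.comp_apply,
    ← AddMonoidHom.mem_ker, ← resKer_eq_ker] at hc
  -- Step 2: the middle kernel is inflated from the open subgroup `N = galRange E'`
  have hN : IsOpen (galRange (K := E) E' : Set (absoluteGaloisGroup E)) :=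
    Subgroup.isOpen_mono (finGalSubgroup_le_range_resGal E') (isOpen_finGalSubgroup E')
  obtain ⟨f, hf⟩ := resKer_le_range_inflClass (resGalOfEmb (K := E) ι₂) (pointsMapTower W ι₂)
    (pointsMapTower_smul W ι₂) (pointsMapTower_bijective W ι₂) (galRange (K := E) E') hN
    (fun _ h ↦ h) hc
  suffices h0 : inflClass (localPoints W E) (galRange (K := E) E') hN f = 0 by
    change resH1Hom (resGalOfEmb ι₁) (pointsMapOfEmb W ι₁) (pointsMapOfEmb_smul W ι₁) c = 0
    rw [← hf, h0]
  -- Step 3: the embedded copy `j : E' → Ē` and the embedded square root `θ' = j θ₁`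
  let e : AlgebraicClosure E ≃ₐ[E] AlgebraicClosure E' := algEquivOfEmb E' ι₂
  let j : E' →ₐ[E] AlgebraicClosure E :=
    (e.symm : AlgebraicClosure E' →ₐ[E] AlgebraicClosure E).comp (IsScalarTower.toAlgHom E E' (AlgebraicClosure E'))
  have hjdef : ∀ x, algEquivOfEmb E' (closureEmb (K := E) E') (j x) = algebraMap E' (AlgebraicClosure E') x :=
    fun x ↦ e.apply_symm_apply _
  obtain ⟨θ', hθ'⟩ : ∃ θ' : AlgebraicClosure E, j θ₁ = θ' := ⟨_, rfl⟩
  have hθ'sq : θ' ^ 2 = algebraMap E (AlgebraicClosure E) a := by rw [← hθ', ← map_pow, hθ₁, AlgHom.commutes]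
  have hθ'0 : θ' ≠ 0 := fun h ↦ ha (by
    rw [h, zero_pow two_ne_zero, eq_comm, map_eq_zero_iff _ (algebraMap E (AlgebraicClosure E)).injective] at hθ'sq
    exact hθ'sq)
  have hθ'neg : -θ' ≠ θ' := fun h ↦ hθ'0 (by
    have : (2 : AlgebraicClosure E) * θ' = 0 := by linear_combination -h
    simpa using this)
  -- the action of `Γ_E` on `θ'`
  obtain ⟨act, hact⟩ : ∃ act : absoluteGaloisGroup E → AlgebraicClosure E,
      ∀ g, act g = (show AlgebraicClosure E ≃ₐ[E] AlgebraicClosure E from g) θ' := ⟨_, fun _ ↦ rfl⟩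
  have act_mul : ∀ b c : absoluteGaloisGroup E,
      act (b * c) = (show AlgebraicClosure E ≃ₐ[E] AlgebraicClosure E from b) (act c) := fun b c ↦ by rw [hact, hact]; rfl
  have act_one : act 1 = θ' := by rw [hact]; rfl
  -- `N` is the stabiliser of `θ'`
  have hfixN : ∀ n ∈ galRange (K := E) E', act n = θ' := fun n hn ↦ by
    rw [hact, ← hθ']
    exact apply_eq_of_mem_galRange' E' j hjdef hn θ₁
  have hmemN : ∀ g : absoluteGaloisGroup E, act g = θ' → g ∈ galRange (K := E) E' := fun g hg ↦ by
    rw [hact] at hg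
    refine mem_galRange_of_forall_apply_eq' E' j hjdef fun x ↦ ?_
    obtain ⟨b, c, rfl⟩ := hE' x
    rw [map_add, map_mul, AlgHom.commutes, AlgHom.commutes, hθ', map_add, map_mul, AlgEquiv.commutes, AlgEquiv.commutes, hg]
  -- every element of `Γ_E` sends `θ'` to `θ'` or to `-θ'`
  have hdich : ∀ g : absoluteGaloisGroup E, act g = θ' ∨ act g = -θ' := fun g ↦ by
    rw [hact]
    have hsq : ((show AlgebraicClosure E ≃ₐ[E] AlgebraicClosure E from g) θ') ^ 2 = θ' ^ 2 := by
      rw [← map_pow, hθ'sq, AlgEquiv.commutes]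
    exact sq_eq_sq_iff_eq_or_eq_neg.mp hsq
  have act_mul_of_eq : ∀ b c : absoluteGaloisGroup E, act c = θ' → act (b * c) = act b := fun b c hc' ↦ by
    rw [act_mul, hc', hact]
  have act_mul_of_eq_neg : ∀ b c : absoluteGaloisGroup E, act c = -θ' → act (b * c) = -act b := fun b c hc' ↦ by
    rw [act_mul, hc', map_neg, hact]
  -- the inverse of an element acts on `θ'` like the element itself
  have hinv : ∀ g : absoluteGaloisGroup E, act g⁻¹ = act g := fun g ↦ by
    have h1 : act (g * g⁻¹) = θ' := by rw [mul_inv_cancel, act_one]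
    rcases hdich g with hg | hg <;> rcases hdich g⁻¹ with hg' | hg'
    · rw [hg, hg']
    · rw [act_mul_of_eq_neg g g⁻¹ hg', hg] at h1
      exact absurd h1 hθ'neg
    · rw [act_mul_of_eq g g⁻¹ hg', hg] at h1
      exact absurd h1 hθ'neg
    · rw [hg, hg']
  -- `N` is normal
  haveI hNn : (galRange (K := E) E').Normal := by
    refine ⟨fun n hn g ↦ hmemN _ ?_⟩
    rcases hdich g with hg | hg
    · rw [act_mul_of_eq _ _ ((hinv g).trans hg), act_mul_of_eq _ _ (hfixN n hn), hg]
    · rw [act_mul_of_eq_neg _ _ ((hinv g).trans hg), act_mul_of_eq _ _ (hfixN n hn), hg, neg_neg]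
  -- Step 4: kill `[f]`
  by_cases hex : ∃ g₀ : absoluteGaloisGroup E, act g₀ = -θ'
  · obtain ⟨g₀, hg₀⟩ := hex
    have hcoset : ∀ g : absoluteGaloisGroup E, g ∈ galRange (K := E) E' ∨ g * g₀⁻¹ ∈ galRange (K := E) E' := fun g ↦ by
      rcases hdich g with hg | hg
      · exact Or.inl (hmemN g hg)
      · refine Or.inr (hmemN _ ?_)
        rw [act_mul_of_eq_neg _ _ ((hinv g₀).trans hg₀), hg, neg_neg]
    have hg₀2 : g₀ * g₀ ∈ galRange (K := E) E' := hmemN _ (by rw [act_mul_of_eq_neg _ _ hg₀, hg₀, neg_neg])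
    -- `θ₁ ∉ E`: `g₀` moves `θ'`
    have hθ₁E : θ₁ ∉ Set.range (algebraMap E E') := by
      rintro ⟨r, hr⟩
      have hfix : (show AlgebraicClosure E ≃ₐ[E] AlgebraicClosure E from g₀) θ' = θ' := by
        rw [← hθ', ← hr, AlgHom.commutes, AlgEquiv.commutes]
      rw [← hact, hg₀] at hfix
      exact hθ'neg hfix
    obtain ⟨π, hπN, hπg₀⟩ := hπ hθ₁E g₀ hcoset
    -- `P := f g₀` is fixed by `N` and flipped by `g₀`; the witness is `Q := -π P`
    have hPflip : g₀ • f.1 g₀ = -f.1 g₀ := by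
      have e₀ := cocyclesVanishingOn.cocycle f g₀ g₀
      rw [cocyclesVanishingOn.apply_of_mem f hg₀2] at e₀
      exact eq_neg_of_add_eq_zero_right e₀.symm
    refine inflClass_eq_zero_of_index_two_of_witness (galRange (K := E) E') hN f hcoset
      (-π (show localPoints W E from f.1 g₀)) (fun n hn ↦ ?_) ?_
    · rw [smul_neg, ← hπN n hn]
      exact congrArg (fun R ↦ -π R) (cocyclesVanishingOn.smul_apply f g₀ hn)
    · rw [smul_neg, hπg₀, hPflip, map_neg]
      abel
  · -- no element acts by `θ' ↦ -θ'`: `N = Γ_E` and `f = 0`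
    simp only [not_exists] at hex
    have hall : ∀ g : absoluteGaloisGroup E, g ∈ galRange (K := E) E' := fun g ↦
      hmemN g ((hdich g).resolve_right (hex g))
    refine inflClass_eq_zero_of_index_two_of_witness (galRange (K := E) E') hN f (g₀ := 1)
      (fun g ↦ Or.inl (hall g)) 0 (fun n _ ↦ smul_zero n) ?_
    rw [smul_zero, sub_zero, cocyclesVanishingOn.apply_of_mem f (Subgroup.one_mem _)]

end Generic

/-! ## §3 The CM class: exact local descent along `E' = E(√−7) ⊇ E` for `j = −3375` -/

section LocalTower

variable (W : WeierstrassCurve ℚ) [W.IsElliptic]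
variable {E : Type} [Field E] [CharZero E] [instE : Algebra ℚ E]
variable {E' : Type} [Field E'] [Algebra ℚ E'] [Algebra E E'] [IsScalarTower ℚ E E'] [FiniteDimensional E E']

/-- **Exact local descent for the CM class at `√−7`.** `E = W/ℚ` elliptic with `j = −3375`; `L` a number field with `θ² = −7`;
`ℚ → E → E'` a tower of fields with `E'/E` finite, `E'` an `L`-algebra, and `E' = E + E·θ₁` for `θ₁ = algebraMap L E' θ`. Then a
class `c ∈ H¹(ℚ, E)` that dies in `H¹(E', E)` dies in `H¹(E, E)`: `localRestrictionKer W E' ≤ localRestrictionKer W E` — the converse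
of the tree's `localRestrictionKer_le_of_tower`, WITHOUT the factor `2`. By `mem_localRestrictionKer_of_tower_of_traceOne`, with the
trace-one witness map `π` = the complex multiplication on `E(Ē)` (`exists_local_cmEndo_two`, read on `localPoints W E` through
`localPointsEquivGeomPoints`): it commutes with `N = res(Γ_{E'})`, and for `g₀` in the other coset `g₀ π g₀⁻¹ = 1 − π` by -w8 g0's
`smul_cmEndo_eq_of_coset_of_not_isSquare` — `√−7 ∉ E` because `θ₁ ∉ E`. Serre, *Galois Cohomology*, I.§2.4, I.§5.8; Gross 1991
§5 (5.1) (shape). [cite: SerreGaloisCohomology1997, I.§2.4 (Prop. 9 and Cor.) and I.§5.8]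
[cite: SilvermanATAEC1994, II §2 Thm. 2.2(b) and App. A §3 (row D = -7)] -/
theorem mem_localRestrictionKer_of_tower_cm7 (hj : W.j = -3375) (L : Type) [Field L] [NumberField L] {θ : L}
    (hθ : θ ^ 2 = -7) [Algebra L E']
    (hE' : ∀ x : E', ∃ b c : E, x = algebraMap E E' b + algebraMap E E' c * algebraMap L E' θ)
    {c : W.galH1} (hc : c ∈ W.localRestrictionKer E') : c ∈ W.localRestrictionKer E := by
  -- normalise the `ℚ`-algebra structure of `E` to the canonical one of a characteristic-zero field
  obtain rfl : instE = DivisionRing.toRatAlgebra := Subsingleton.elim _ _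
  haveI : Algebra.IsAlgebraic E E' := Algebra.IsAlgebraic.of_finite E E'
  have hθ₁ : (algebraMap L E' θ) ^ 2 = algebraMap E E' (-7) := by
    rw [← map_pow, hθ, map_neg, map_ofNat, map_neg, map_ofNat]
  refine mem_localRestrictionKer_of_tower_of_traceOne W (by norm_num : (-7 : E) ≠ 0) hθ₁ hE' (fun hθ₁E g₀ hcoset ↦ ?_) hc
  -- `√−7 ∉ E`
  have h7 : ¬ IsSquare (-7 : E) := by
    rintro ⟨r, hr⟩
    have hsq : (algebraMap L E' θ) ^ 2 = (algebraMap E E' r) ^ 2 := by rw [hθ₁, hr, map_mul, sq]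
    rcases sq_eq_sq_iff_eq_or_eq_neg.mp hsq with h | h
    · exact hθ₁E ⟨r, h.symm⟩
    · exact hθ₁E ⟨-r, by rw [map_neg, h]⟩
  -- the complex multiplication on `E(Ē)`, read on `localPoints W E`
  obtain ⟨π, hπ, hrel, hker, hker', hπN⟩ := exists_local_cmEndo_two W hj L hθ E E'
  let cg := localPointsEquivGeomPoints W E
  have hcg : ∀ (g : absoluteGaloisGroup E) (R : localPoints W E), cg (g • R) = g • cg R :=
    localPointsEquivGeomPoints_smul W E
  have hcg' : ∀ (g : absoluteGaloisGroup E) (S : (W.baseChange E).geomPoints), cg.symm (g • S) = g • cg.symm S :=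
    fun g S ↦ cg.injective (by rw [AddEquiv.apply_symm_apply, hcg, AddEquiv.apply_symm_apply])
  let πE : localPoints W E →+ localPoints W E :=
    (cg.symm.toAddMonoidHom.comp (π : (W.baseChange E).geomPoints →+ (W.baseChange E).geomPoints)).comp cg.toAddMonoidHom
  have hπE : ∀ R, πE R = cg.symm (π (cg R)) := fun _ ↦ rfl
  have hNπ : ∀ n ∈ galRange (K := E) E', ∀ S : (W.baseChange E).geomPoints, n • π S = π (n • S) := by
    rintro _ ⟨σ, rfl⟩ S
    exact (hπN σ S).symm
  refine ⟨πE, fun n hn R ↦ ?_, fun R ↦ ?_⟩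
  · rw [hπE, hπE, hcg, ← hNπ n hn, hcg']
  · rw [hπE, hπE, ← hcg', smul_cmEndo_eq_of_coset_of_not_isSquare W E hj h7 hπ hrel hker hker' hNπ hcoset (cg R),
      map_sub, ← hcg, AddEquiv.symm_apply_apply]

/-- **Binder form: `localRestrictionKer E' = localRestrictionKer E`** for `[E' : E] ≤ 2` generated by `√−7` and `j = −3375` (the
tree's `localRestrictionKer_le_of_tower` gives the other inclusion). [cite: SerreGaloisCohomology1997, I.§2.4 (Prop. 9 and Cor.) and I.§5.8] -/
theorem localRestrictionKer_eq_of_tower_cm7 (hj : W.j = -3375) (L : Type) [Field L] [NumberField L] {θ : L}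
    (hθ : θ ^ 2 = -7) [Algebra L E']
    (hE' : ∀ x : E', ∃ b c : E, x = algebraMap E E' b + algebraMap E E' c * algebraMap L E' θ) :
    W.localRestrictionKer E' = W.localRestrictionKer E :=
  le_antisymm (fun _ hc ↦ mem_localRestrictionKer_of_tower_cm7 W hj L hθ hE' hc) (localRestrictionKer_le_of_tower W)

end LocalTower

end Summit.BirchSwinnertonDyer.BirchSwinnertonDyer.Theorems.PrintCf2.CMPrimes

end
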